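import Summits.HodgeConjecture.HodgeConjecture.Theorems.WeilTypeLadderTargetTransfer
import Summits.HodgeConjecture.HodgeConjecture.Theorems.WeilTypeLadderCyclicPrymRealRoots
import Literature.AlgebraicGeometry.HodgeTheory.FermatHodgeConjectureProducts
import Mathlib.RingTheory.Polynomial.Cyclotomic.Roots
import Mathlib.RingTheory.Polynomial.Eisenstein.Basic
import Mathlib.Tactic.ComputeDegree
import HarnessLib

/-!
# WeilTypeLadder · R3 (`WeilClassesCMField`) for the CM subfield `K′ = ℚ(ζ_37)^{C_9} ⊂ ℚ(ζ_37)` of DEGREE FOUR (`[K′:ℚ] = 4`, `[E:K′] = 9`):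
# minimal polynomial `T ^ 4 + 37 * T ^ 2 + 333` of `θ = η − η̄` (`η = ζ + ζ^7 + ζ^9 + ζ^10 + ζ^12 + ζ^16 + ζ^26 + ζ^33 + ζ^34`); the rung's eight arithmetic
# hypotheses DISCHARGED (Eisenstein at `37`; purely imaginary roots by the sign-change criterion for the quadratic `P₀`; `Q = −T`;
# `P(φ) = 0 ⇐ Φ_37(s) = 0` by a chain in `ℤ[T]/(T^37 − 1)`); the transfer over the nine-fold Fermat product `(Xʰ_37)^{⊗9}`

b2b cell `hweil` (packet `run/shared/lean/b2b/hodge-weil/`, report `b2b-hweil-pv3-g45/GENERIC-HODGE-GROUP.md` §9; on the cell lead's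
word, carver-g114: «open `hodgeClasses_algebraic_fermatProduct₅/₇/₉`, then place the s = 5 / 7 / 9 rows via COROLLARY R3-CYC′»). `E = ℚ(ζ_37)`,
`U ≅ ℤ/36`, `H′ = C_9 = {1, 7, 9, 10, 12, 16, 26, 33, 34}`, `K′ = E^{H′}` (CM of degree `4`; `K′⁺` real of degree `2`), `s = [E:K′] = 9`:
PROPOSITION CYC′ of [P3-g43] transfers the `K′`-Weil classes of the `ζ_37`-primitive Prym of a `ℤ/37`-cover of `ℙ¹` to `(Xʰ_37)^{⊗9}`
(`hodgeClasses_algebraic_fermatProduct₉`; `37` is prime — Shioda's range). Generator `θ := η − η̄` (`η` the Gaussian period of `H′`,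
`θ̄ = −θ`), minimal polynomial **`P = T ^ 4 + 37 * T ^ 2 + 333`** `= P₀(T²)`, `P₀ = u ^ 2 + 37 * u + 333` (Eisenstein at `37`; computed EXACTLY in
`ℤ[ζ_37]` by `code/pv3-g45/periods2.py` = [P3-g44]'s `periods.py` with `C₃` replaced by `C_s`). On `B` with `Φ_37(s) = 0`:
**`φ := s + s^7 + s^9 + s^10 + s^12 + s^16 + s^26 + s^33 + s^34 - s^3 - s^4 - s^11 - s^21 - s^25 - s^27 - s^28 - s^30 - s^36`**. `P(φ) = 0` by [P3-g44]'s device: work modulo `T^37 − 1`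
— `s^37 = 1` follows from `Φ_37(s) = 0` (`geom_sum_mul`) —, with the powers
`φ^k ≡ r̃_k` (`k ≤ 4`) reduced by EXPONENT ARITHMETIC only (`r̃_k·φ = r̃_{k+1} + (T^37 − 1)·w_k`, each a `ring` identity between
polynomials written COMPACTLY as `∑ i ∈ range 37, C (Lᵢ) T^i` from integer coefficient LISTS), and the final identity
`Σᵢ aᵢ r̃_{2i} + a₀ = 9·Φ_37(T)` EXACTLY (both sides of degree `< 37`; LEMMA AUG: the constant is `P(0)/37 = 9`).
Dimensions: `dim B = 18h`, `h = 2n`, classes `weilClassesField B φ P (18n) ⊂ H^{18n}(B)` (`hs = 9·2n`), `e·(2m) = 4·18n = 2·dim B = 2·36n`.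

What is PROVED here (kernel): (§1) `P` monic of degree `4`, irreducible over `ℚ` (Eisenstein + Gauss); `P₀` has `2` sign changes at
`u = -22, -21, -15` (values `3, -3, 3`), hence only real roots
(`conj_eq_self_of_sign_changes` of `…CyclicPrymRealRoots`); so a complex root `ρ` of `P` has `ρ̄² = ρ²`, `ρ̄ ≠ ρ` (`P > 0` on `ℝ`),
`ρ̄ = −ρ`: «no real root» and `Q = −T`; the 3 chain identities and the final identity (`simp` expansion + `ring`); `P(φ) = 0`.
(§2) the R3 body over `(((((((X₁ ⊗ X₂) ⊗ X₃) ⊗ X₄) ⊗ X₅) ⊗ X₆) ⊗ X₇) ⊗ X₈) ⊗ X₉`, `Xᵢ = X^{2n}_37`, from the two refereed named facts; from the rung (HONEST SPECIALISATION at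
`(B, φ, P, 4, 9n)`, all eight hypotheses discharged); ON-PATH.

What is NOT in the kernel: the datum (PROPOSITION CYC′) and `K′`-Weil-ness (THEOREM W′); the census of the `K′`-Weil NON-`E`-Weil
families (report §9; `code/pv3-g45/kfam.py`). HONEST LABEL: sub-families, never the general member; 0 unconditional rungs above the floor; conditional on
[Shioda 1979 Thm. 2] + [Fulton 1998 Cor. 19.2 (b)] (refereed) and on the datum; Markman-free; the standing `weilClassesField`
identification flag applies. No `sorry`, no new definition, no new named fact.
-/

noncomputable section

-- every declaration of this problem lives in `Summit.HodgeConjecture.HodgeConjecture.…` (summit = sub-problem)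
set_option linter.dupNamespace false

open CategoryTheory MonoidalCategory Polynomial
open Literature.AlgebraicGeometry Literature.AlgebraicGeometry.Motives
open Literature.AlgebraicGeometry.HodgeTheory
open Literature.AlgebraicTopology.SingularHomology

namespace Summit.HodgeConjecture.HodgeConjecture.WeilTypeLadder

/-! ### §1 The quartic `T ^ 4 + 37 * T ^ 2 + 333`, the quadratic `P₀`, and the chain modulo `T^37 − 1` -/

section Quartic

/-- `T ^ 4 + 37 * T ^ 2 + 333 ∈ ℤ[T]` is monic. [folklore] -/
theorem quarticThirtySeven_monic : (X ^ 4 + 37 * X ^ 2 + 333 : Polynomial ℤ).Monic := by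
  monicity!

/-- `T ^ 4 + 37 * T ^ 2 + 333` has degree `4`. [folklore] -/
theorem quarticThirtySeven_natDegree : (X ^ 4 + 37 * X ^ 2 + 333 : Polynomial ℤ).natDegree = 4 := by
  compute_degree!

/-- The coefficients of `T ^ 4 + 37 * T ^ 2 + 333` below the top one are divisible by `37`. [folklore] -/
theorem quarticThirtySeven_coeff_mem {n : ℕ} (hn : n < 4) :
    (X ^ 4 + 37 * X ^ 2 + 333 : Polynomial ℤ).coeff n ∈ Ideal.span {(37 : ℤ)} := by
  rw [Ideal.mem_span_singleton]
  interval_cases n <;> simp [coeff_X_pow, coeff_ofNat_mul]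

/-- `T ^ 4 + 37 * T ^ 2 + 333` is Eisenstein at `(37)`. [folklore] -/
theorem quarticThirtySeven_isEisensteinAt :
    (X ^ 4 + 37 * X ^ 2 + 333 : Polynomial ℤ).IsEisensteinAt (Ideal.span {(37 : ℤ)}) where
  leading := by
    rw [Polynomial.Monic.leadingCoeff quarticThirtySeven_monic, Ideal.mem_span_singleton]; norm_num
  mem := fun {n} hn => quarticThirtySeven_coeff_mem (by rwa [quarticThirtySeven_natDegree] at hn)
  notMem := by
    rw [Ideal.span_singleton_pow, Ideal.mem_span_singleton]
    simp [coeff_X_pow, coeff_ofNat_mul]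

/-- `T ^ 4 + 37 * T ^ 2 + 333` is irreducible over `ℚ` (Eisenstein at `37` over `ℤ`, then Gauss's lemma). [folklore] -/
theorem quarticThirtySeven_irreducible :
    Irreducible ((X ^ 4 + 37 * X ^ 2 + 333 : Polynomial ℤ).map (Int.castRingHom ℚ)) := by
  have hprime : (Ideal.span {(37 : ℤ)}).IsPrime :=
    (Ideal.span_singleton_prime (by norm_num)).mpr (Nat.prime_iff_prime_int.mp (by norm_num))
  have hZ : Irreducible (X ^ 4 + 37 * X ^ 2 + 333 : Polynomial ℤ) :=
    quarticThirtySeven_isEisensteinAt.irreducible hprime quarticThirtySeven_monic.isPrimitive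
      (by rw [quarticThirtySeven_natDegree]; norm_num)
  have := (Polynomial.IsPrimitive.irreducible_iff_irreducible_map_fraction_map (K := ℚ)
    quarticThirtySeven_monic.isPrimitive).1 hZ
  rwa [← algebraMap_int_eq]

/-- Evaluation of `T ^ 4 + 37 * T ^ 2 + 333` in any ring. -/
theorem eval₂_quarticThirtySeven {R : Type*} [Ring R] (x : R) :
    Polynomial.eval₂ (Int.castRingHom R) x (X ^ 4 + 37 * X ^ 2 + 333 : Polynomial ℤ) =
      x ^ 4 + 37 * x ^ 2 + 333 := by
  rw [← algebraMap_int_eq, ← Polynomial.aeval_def]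
  simp only [map_add, map_mul, map_pow, Polynomial.aeval_X, map_ofNat]

/-- For a complex root `ρ` of `T ^ 4 + 37 * T ^ 2 + 333`, `ρ²` is a root of the quadratic
`P₀ = u ^ 2 + 37 * u + 333`, which has `2` consecutive sign changes at `u = -22, -21, -15`
(`P₀(u) = 3, -3, 3`), hence only real roots (`conj_eq_self_of_sign_changes`): `ρ̄² = ρ²`. [folklore] -/
theorem conj_sq_eq_sq_of_quarticThirtySeven {ρ : ℂ} (hρ : ρ ^ 4 + 37 * ρ ^ 2 + 333 = 0) :
    starRingEnd ℂ (ρ ^ 2) = ρ ^ 2 := by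
  refine conj_eq_self_of_sign_changes (X ^ 2 + 37 * X + 333 : Polynomial ℝ) 1 (by monicity!) (by compute_degree!)
    (fun i => (([-22, -21, -15] : List ℝ).getD i 0)) (by intro i hi; interval_cases i <;> norm_num)
    (by intro i hi; interval_cases i <;> norm_num) ?_
  simp only [map_add, map_mul, map_pow, Polynomial.aeval_X, map_ofNat]
  linear_combination hρ

/-- The complex roots of `T ^ 4 + 37 * T ^ 2 + 333` are NON-REAL (`P > 0` on `ℝ`): the rung's "no real root". [folklore] -/
theorem conj_ne_self_of_quarticThirtySeven {ρ : ℂ}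
    (hρ : Polynomial.eval₂ (Int.castRingHom ℂ) ρ (X ^ 4 + 37 * X ^ 2 + 333 : Polynomial ℤ) = 0) :
    starRingEnd ℂ ρ ≠ ρ := by
  rw [eval₂_quarticThirtySeven] at hρ
  intro hc
  have hre : ((ρ.re : ℝ) : ℂ) = ρ := Complex.conj_eq_iff_re.mp hc
  have hr : ((ρ.re ^ 4 + 37 * ρ.re ^ 2 + 333 : ℝ) : ℂ) = 0 := by push_cast; rw [hre]; exact hρ
  have hr' : ρ.re ^ 4 + 37 * ρ.re ^ 2 + 333 = 0 := by exact_mod_cast hr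
  have hpos : 0 < ρ.re ^ 4 + 37 * ρ.re ^ 2 + 333 := by positivity
  exact absurd hr' (ne_of_gt hpos)

/-- `Q = −T` carries every complex root of `T ^ 4 + 37 * T ^ 2 + 333` to its conjugate: the rung's "CM involution is a polynomial". [folklore] -/
theorem exists_conjPolynomial_quarticThirtySeven :
    ∃ Q : Polynomial ℚ, ∀ ρ : ℂ, Polynomial.eval₂ (Int.castRingHom ℂ) ρ (X ^ 4 + 37 * X ^ 2 + 333 : Polynomial ℤ) = 0 →
      Polynomial.eval₂ (algebraMap ℚ ℂ) ρ Q = starRingEnd ℂ ρ := by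
  refine ⟨-Polynomial.X, fun ρ hρ => ?_⟩
  have hne := conj_ne_self_of_quarticThirtySeven hρ
  rw [eval₂_quarticThirtySeven] at hρ
  rw [Polynomial.eval₂_neg, Polynomial.eval₂_X]
  exact (conj_eq_neg_of_conj_sq_eq (conj_sq_eq_sq_of_quarticThirtySeven hρ) hne).symm

/-- Chain modulo `T^37 − 1`, step 1: `φ·φ = r̃₂ + (T^37 − 1)·w₁` in `ℤ[T]` (`φ = X + X^7 + X^9 + X^10 + X^12 + X^16 + X^26 + X^33 + X^34 - X^3 - X^4 - X^11 - X^21 - X^25 - X^27 - X^28 - X^30 - X^36`; `r̃₂`, `w₁` from their integer coefficient lists; exponent arithmetic only). [folklore] -/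
theorem quarticThirtySeven_step1 :
    ((X + X ^ 7 + X ^ 9 + X ^ 10 + X ^ 12 + X ^ 16 + X ^ 26 + X ^ 33 + X ^ 34 - X ^ 3 - X ^ 4 - X ^ 11 - X ^ 21 - X ^ 25 - X ^ 27 - X ^ 28 - X ^ 30 - X ^ 36) * (X + X ^ 7 + X ^ 9 + X ^ 10 + X ^ 12 + X ^ 16 + X ^ 26 + X ^ 33 + X ^ 34 - X ^ 3 - X ^ 4 - X ^ 11 - X ^ 21 - X ^ 25 - X ^ 27 - X ^ 28 - X ^ 30 - X ^ 36) : Polynomial ℤ) =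
      (∑ i ∈ Finset.range 36, C (([-18, 0, 1, 0, 0, 1, 1, 0, 1, 0, 0, 0, 0, 1, 1, 1, 0, 1, 1, 1, 1, 0, 1, 1, 1, 0, 0, 0, 0, 1, 0, 1, 1, 0, 0, 1] : List ℤ).getD i 0) * X ^ i) +
      (X ^ 37 - 1 : Polynomial ℤ) * (∑ i ∈ Finset.range 36, C (([-18, 0, 0, 0, 2, 3, 0, -2, -2, 0, 0, 0, 4, 3, 0, 1, 0, -3, 2, -1, 4, 0, 0, 1, -2, -4, 0, 0, 0, 3, 2, 1, -2, -2, 0, 1] : List ℤ).getD i 0) * X ^ i) := by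
  simp [Finset.sum_range_succ]
  ring

/-- Chain modulo `T^37 − 1`, step 2: `r̃_2·φ = r̃_3 + (T^37 − 1)·w_2` (`r̃_3 ≡ φ^3`, coefficient lists). [folklore] -/
theorem quarticThirtySeven_step2 :
    (∑ i ∈ Finset.range 36, C (([-18, 0, 1, 0, 0, 1, 1, 0, 1, 0, 0, 0, 0, 1, 1, 1, 0, 1, 1, 1, 1, 0, 1, 1, 1, 0, 0, 0, 0, 1, 0, 1, 1, 0, 0, 1] : List ℤ).getD i 0) * X ^ i) * (X + X ^ 7 + X ^ 9 + X ^ 10 + X ^ 12 + X ^ 16 + X ^ 26 + X ^ 33 + X ^ 34 - X ^ 3 - X ^ 4 - X ^ 11 - X ^ 21 - X ^ 25 - X ^ 27 - X ^ 28 - X ^ 30 - X ^ 36) =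
      (∑ i ∈ Finset.range 37, C (([0, -19, 3, 19, 19, -3, -3, -19, -3, -19, -19, 19, -19, -3, 3, 3, -19, -3, 3, -3, 3, 19, -3, -3, 3, 19, -19, 19, 19, 3, 19, 3, 3, -19, -19, -3, 19] : List ℤ).getD i 0) * X ^ i) +
      (X ^ 37 - 1 : Polynomial ℤ) * (∑ i ∈ Finset.range 35, C (([0, -1, 3, 0, 1, -2, -3, -2, -2, -1, 0, 1, -2, -3, 0, -1, -1, -2, 1, -2, 1, 0, -4, -3, 0, -1, 0, 1, 0, 1, -1, 0, 1, 0, -1] : List ℤ).getD i 0) * X ^ i) := by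
  simp [Finset.sum_range_succ]
  ring

/-- Chain modulo `T^37 − 1`, step 3: `r̃_3·φ = r̃_4 + (T^37 − 1)·w_3` (`r̃_4 ≡ φ^4`, coefficient lists). [folklore] -/
theorem quarticThirtySeven_step3 :
    (∑ i ∈ Finset.range 37, C (([0, -19, 3, 19, 19, -3, -3, -19, -3, -19, -19, 19, -19, -3, 3, 3, -19, -3, 3, -3, 3, 19, -3, -3, 3, 19, -19, 19, 19, 3, 19, 3, 3, -19, -19, -3, 19] : List ℤ).getD i 0) * X ^ i) * (X + X ^ 7 + X ^ 9 + X ^ 10 + X ^ 12 + X ^ 16 + X ^ 26 + X ^ 33 + X ^ 34 - X ^ 3 - X ^ 4 - X ^ 11 - X ^ 21 - X ^ 25 - X ^ 27 - X ^ 28 - X ^ 30 - X ^ 36) =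
      (∑ i ∈ Finset.range 37, C (([342, 9, -28, 9, 9, -28, -28, 9, -28, 9, 9, 9, 9, -28, -28, -28, 9, -28, -28, -28, -28, 9, -28, -28, -28, 9, 9, 9, 9, -28, 9, -28, -28, 9, 9, -28, 9] : List ℤ).getD i 0) * X ^ i) +
      (X ^ 37 - 1 : Polynomial ℤ) * (∑ i ∈ Finset.range 36, C (([342, 9, -9, 6, -29, -63, -3, 50, 26, 3, 6, 3, -70, -60, -6, -22, 3, 51, -35, 7, -79, 6, -6, -22, 32, 79, 6, 3, 6, -54, -41, -25, 35, 38, 3, -19] : List ℤ).getD i 0) * X ^ i) := by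
  simp [Finset.sum_range_succ]
  ring

/-- The final identity, EXACT in `ℤ[T]` (degrees `< 37`): `r̃_4 + 37·r̃_2 + 333 = 9·Φ_37(T) = 9·Σ_{i<37} Tⁱ` (the reduction of `P(φ)` modulo `T^37 − 1`
is `(P(0)/37)·Φ_37`; check at `T = 1`: `P(φ(1)) = P(0) = 333 = 9·Φ_37(1)`). [folklore] -/
theorem quarticThirtySeven_final :
    ((∑ i ∈ Finset.range 37, C (([342, 9, -28, 9, 9, -28, -28, 9, -28, 9, 9, 9, 9, -28, -28, -28, 9, -28, -28, -28, -28, 9, -28, -28, -28, 9, 9, 9, 9, -28, 9, -28, -28, 9, 9, -28, 9] : List ℤ).getD i 0) * X ^ i) +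
        37 * (∑ i ∈ Finset.range 36, C (([-18, 0, 1, 0, 0, 1, 1, 0, 1, 0, 0, 0, 0, 1, 1, 1, 0, 1, 1, 1, 1, 0, 1, 1, 1, 0, 0, 0, 0, 1, 0, 1, 1, 0, 0, 1] : List ℤ).getD i 0) * X ^ i) +
        333 : Polynomial ℤ) =
      9 * ∑ i ∈ Finset.range 37, (X : Polynomial ℤ) ^ i := by
  simp [Finset.sum_range_succ]
  ring

/-- `Φ_37(s) = 0 ⟹ P(s + s^7 + s^9 + s^10 + s^12 + s^16 + s^26 + s^33 + s^34 - s^3 - s^4 - s^11 - s^21 - s^25 - s^27 - s^28 - s^30 - s^36) = 0` in any ring, `P = T ^ 4 + 37 * T ^ 2 + 333`: `s^37 = 1` (`geom_sum_mul`), `y = φ(s)`,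
`y^k = r̃_k(s)` for `k ≤ 4` by the chain, and `Σᵢ aᵢ r̃_{2i}(s) + a₀ = 9·Φ_37(s) = 0`. [folklore] -/
theorem eval₂_quarticThirtySeven_periodDiff {R : Type*} [Ring R] (s : R)
    (hs : Polynomial.eval₂ (Int.castRingHom R) s (Polynomial.cyclotomic 37 ℤ) = 0) :
    Polynomial.eval₂ (Int.castRingHom R) (s + s ^ 7 + s ^ 9 + s ^ 10 + s ^ 12 + s ^ 16 + s ^ 26 + s ^ 33 + s ^ 34 - s ^ 3 - s ^ 4 - s ^ 11 - s ^ 21 - s ^ 25 - s ^ 27 - s ^ 28 - s ^ 30 - s ^ 36)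
      (X ^ 4 + 37 * X ^ 2 + 333 : Polynomial ℤ) = 0 := by
  haveI : Fact (Nat.Prime 37) := ⟨by norm_num⟩
  rw [Polynomial.cyclotomic_prime, ← algebraMap_int_eq, ← Polynomial.aeval_def] at hs
  rw [eval₂_quarticThirtySeven]
  have hsum : (∑ i ∈ Finset.range 37, s ^ i) = 0 := by
    simpa only [map_sum, map_pow, Polynomial.aeval_X] using hs
  have hsp : s ^ 37 = 1 := by rw [← sub_eq_zero, ← geom_sum_mul, hsum, zero_mul]
  have hXp : Polynomial.aeval s (X ^ 37 - 1 : Polynomial ℤ) = 0 := by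
    rw [map_sub, map_pow, Polynomial.aeval_X, map_one, hsp, sub_self]
  generalize hφy : (s + s ^ 7 + s ^ 9 + s ^ 10 + s ^ 12 + s ^ 16 + s ^ 26 + s ^ 33 + s ^ 34 - s ^ 3 - s ^ 4 - s ^ 11 - s ^ 21 - s ^ 25 - s ^ 27 - s ^ 28 - s ^ 30 - s ^ 36 : R) = y
  have hy : y = Polynomial.aeval s ((X + X ^ 7 + X ^ 9 + X ^ 10 + X ^ 12 + X ^ 16 + X ^ 26 + X ^ 33 + X ^ 34 - X ^ 3 - X ^ 4 - X ^ 11 - X ^ 21 - X ^ 25 - X ^ 27 - X ^ 28 - X ^ 30 - X ^ 36) : Polynomial ℤ) := by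
    rw [← hφy]; simp only [map_add, map_sub, map_pow, Polynomial.aeval_X]
  have hy2 : y ^ 2 = Polynomial.aeval s (∑ i ∈ Finset.range 36, C (([-18, 0, 1, 0, 0, 1, 1, 0, 1, 0, 0, 0, 0, 1, 1, 1, 0, 1, 1, 1, 1, 0, 1, 1, 1, 0, 0, 0, 0, 1, 0, 1, 1, 0, 0, 1] : List ℤ).getD i 0) * X ^ i) := by
    rw [pow_two, hy, ← map_mul, quarticThirtySeven_step1, map_add, map_mul, hXp, zero_mul, add_zero]
  have hy3 : y ^ 3 = Polynomial.aeval s (∑ i ∈ Finset.range 37, C (([0, -19, 3, 19, 19, -3, -3, -19, -3, -19, -19, 19, -19, -3, 3, 3, -19, -3, 3, -3, 3, 19, -3, -3, 3, 19, -19, 19, 19, 3, 19, 3, 3, -19, -19, -3, 19] : List ℤ).getD i 0) * X ^ i) := by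
    rw [show y ^ 3 = y ^ 2 * y from pow_succ y 2, hy2, hy, ← map_mul, quarticThirtySeven_step2, map_add, map_mul, hXp,
      zero_mul, add_zero]
  have hy4 : y ^ 4 = Polynomial.aeval s (∑ i ∈ Finset.range 37, C (([342, 9, -28, 9, 9, -28, -28, 9, -28, 9, 9, 9, 9, -28, -28, -28, 9, -28, -28, -28, -28, 9, -28, -28, -28, 9, 9, 9, 9, -28, 9, -28, -28, 9, 9, -28, 9] : List ℤ).getD i 0) * X ^ i) := by
    rw [show y ^ 4 = y ^ 3 * y from pow_succ y 3, hy3, hy, ← map_mul, quarticThirtySeven_step3, map_add, map_mul, hXp,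
      zero_mul, add_zero]
  have hfin := congrArg (Polynomial.aeval s) quarticThirtySeven_final
  rw [map_mul, hs, mul_zero] at hfin
  simp only [map_add, map_mul, map_ofNat] at hfin
  rw [hy4, hy2]
  exact hfin

end Quartic

/-! ### §2 R3 for `K′ = ℚ(ζ_37)^{C_9} = ℚ(φ)` (degree `4`) on the `ζ_37`-primitive loci over the nine-fold Fermat product `(Xʰ_37)^{⊗9}` -/

section ThirtySevenQuartic

/-- **R3 for the degree-4 field `K′ = ℚ(ζ_37)^{C_9}` on the `(Xʰ_37)^{⊗9}`-dominated `ζ_37`-locus, from the two named facts.** For an abelian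
variety `B` with `s : B ⟶ B`, `Φ_37(s) = 0`, `dim B = 36n` (`h = 2n`), and a datum (`X₁, …, X₉` smooth projective Fermat varieties
`X^{2n}_37`, `T`, `a` surjective, `b : ι → (T ⟶ (((((((X₁ ⊗ X₂) ⊗ X₃) ⊗ X₄) ⊗ X₅) ⊗ X₆) ⊗ X₇) ⊗ X₈) ⊗ X₉)`), every class of `weilClassesField B φ P (18n)`
(`φ = s + s^7 + s^9 + s^10 + s^12 + s^16 + s^26 + s^33 + s^34 - s^3 - s^4 - s^11 - s^21 - s^25 - s^27 - s^28 - s^30 - s^36`, `P = T ^ 4 + 37 * T ^ 2 + 333`) whose pull-back lies in `⨆ᵢ (bᵢ)^*(span of the rational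
(9n,9n)-classes)` and which is rational of type `(9n,9n)` is algebraic.
[cite: Shioda1979PJA, §2 Thm. 2 (p. 112) with the list after Thm. 1] [cite: Fulton1998, §19.2 Cor. 19.2 (b)] [cite: MoonenZarhin1998WeilClasses, §1] -/
theorem weilClassesCMField_cyclicPrymThirtySeven_quartic_of_facts
    (hF₉ : hodgeClasses_algebraic_fermatProduct₉) (hP : fulton1998_map_mem_algebraicClasses) :
    ∀ (B : Motives.AbelianVariety ℂ) (s : B ⟶ B) (n : ℕ),
      Polynomial.eval₂ (Int.castRingHom (CategoryTheory.End B)) (s : CategoryTheory.End B)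
        (Polynomial.cyclotomic 37 ℤ) = 0 → B.dim = 36 * n →
    ∀ (X₁ X₂ X₃ X₄ X₅ X₆ X₇ X₈ X₉ T : Motives.SchemeOver ℂ),
      IsFermatVariety (2 * n) 37 X₁ → IsSmoothProjective (2 * n) X₁ →
      IsFermatVariety (2 * n) 37 X₂ → IsSmoothProjective (2 * n) X₂ →
      IsFermatVariety (2 * n) 37 X₃ → IsSmoothProjective (2 * n) X₃ →
      IsFermatVariety (2 * n) 37 X₄ → IsSmoothProjective (2 * n) X₄ →
      IsFermatVariety (2 * n) 37 X₅ → IsSmoothProjective (2 * n) X₅ →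
      IsFermatVariety (2 * n) 37 X₆ → IsSmoothProjective (2 * n) X₆ →
      IsFermatVariety (2 * n) 37 X₇ → IsSmoothProjective (2 * n) X₇ →
      IsFermatVariety (2 * n) 37 X₈ → IsSmoothProjective (2 * n) X₈ →
      IsFermatVariety (2 * n) 37 X₉ → IsSmoothProjective (2 * n) X₉ →
      IsSmoothProjective B.dim T →
    ∀ (a : T ⟶ B.X), AlgebraicGeometry.Surjective a.left → ∀ (ι : Type) (b : ι → (T ⟶ (((((((X₁ ⊗ X₂) ⊗ X₃) ⊗ X₄) ⊗ X₅) ⊗ X₆) ⊗ X₇) ⊗ X₈) ⊗ X₉)),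
      ∀ c ∈ weilClassesField B
          (CategoryTheory.End.asHom (CategoryTheory.End.of s + CategoryTheory.End.of s ^ 7 + CategoryTheory.End.of s ^ 9 + CategoryTheory.End.of s ^ 10 + CategoryTheory.End.of s ^ 12 + CategoryTheory.End.of s ^ 16 + CategoryTheory.End.of s ^ 26 + CategoryTheory.End.of s ^ 33 + CategoryTheory.End.of s ^ 34 - CategoryTheory.End.of s ^ 3 - CategoryTheory.End.of s ^ 4 - CategoryTheory.End.of s ^ 11 - CategoryTheory.End.of s ^ 21 - CategoryTheory.End.of s ^ 25 - CategoryTheory.End.of s ^ 27 - CategoryTheory.End.of s ^ 28 - CategoryTheory.End.of s ^ 30 - CategoryTheory.End.of s ^ 36))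
          (X ^ 4 + 37 * X ^ 2 + 333 : Polynomial ℤ) (2 * (9 * n)),
        complexBetti.map a (2 * (9 * n)) c ∈ (⨆ i, (Submodule.span ℂ
            {x : complexBetti ((((((((X₁ ⊗ X₂) ⊗ X₃) ⊗ X₄) ⊗ X₅) ⊗ X₆) ⊗ X₇) ⊗ X₈) ⊗ X₉) (2 * (9 * n)) |
              IsRationalClass x ∧ IsOfHodgeType (2 * n + 2 * n + 2 * n + 2 * n + 2 * n + 2 * n + 2 * n + 2 * n + 2 * n) ((((((((X₁ ⊗ X₂) ⊗ X₃) ⊗ X₄) ⊗ X₅) ⊗ X₆) ⊗ X₇) ⊗ X₈) ⊗ X₉) (2 * (9 * n)) (9 * n) (9 * n) x}).map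
              (complexBetti.map (b i) (2 * (9 * n))).hom) →
        IsRationalClass c → IsOfHodgeType B.dim B.X (2 * (9 * n)) (9 * n) (9 * n) c → c ∈ algebraicClasses B.X (9 * n) := by
  intro B s n _ _ X₁ X₂ X₃ X₄ X₅ X₆ X₇ X₈ X₉ T hF₁' hX₁ hF₂' hX₂ hF₃' hX₃ hF₄' hX₄ hF₅' hX₅ hF₆' hX₆ hF₇' hX₇ hF₈' hX₈ hF₉' hX₉ hT a ha ι b c _ hc _ _
  exact abelianVariety_mem_algebraicClasses_of_targetTransferFamily hP B ((((((((hX₁.tensor_holds hX₂).tensor_holds hX₃).tensor_holds hX₄).tensor_holds hX₅).tensor_holds hX₆).tensor_holds hX₇).tensor_holds hX₈).tensor_holds hX₉)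
    (span_rational_hodge_le_algebraicClasses_fermatProduct₉ hF₉ (Or.inl (by norm_num)) hF₁' hX₁ hF₂' hX₂ hF₃' hX₃ hF₄' hX₄ hF₅' hX₅ hF₆' hX₆ hF₇' hX₇ hF₈' hX₈ hF₉' hX₉ (9 * n))
    hT a b hc

-- the 18-term `φ` under the coercion `End.asHom` exceeds the default unifier recursion depth (512) in `hφ` below; nothing else is raised
set_option maxRecDepth 4096 in
/-- **The same body from the rung R3 itself** — an HONEST SPECIALISATION at `(A, φ, P, e, m) := (B, φ, T ^ 4 + 37 * T ^ 2 + 333, 4, 9n)`: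
`P` monic irreducible of degree `4 > 2` (Eisenstein at `37`), `P(φ) = 0` from `Φ_37(s) = 0`, `4·(2·9n) = 2·dim B`, roots non-real,
`Q = −T` — every arithmetic hypothesis DISCHARGED; the datum is not used. -/
theorem weilClassesCMField_cyclicPrymThirtySeven_quartic_of_weilClassesCMField (hR : WeilClassesCMField) :
    ∀ (B : Motives.AbelianVariety ℂ) (s : B ⟶ B) (n : ℕ),
      Polynomial.eval₂ (Int.castRingHom (CategoryTheory.End B)) (s : CategoryTheory.End B)
        (Polynomial.cyclotomic 37 ℤ) = 0 → B.dim = 36 * n →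
    ∀ (X₁ X₂ X₃ X₄ X₅ X₆ X₇ X₈ X₉ T : Motives.SchemeOver ℂ),
      IsFermatVariety (2 * n) 37 X₁ → IsSmoothProjective (2 * n) X₁ →
      IsFermatVariety (2 * n) 37 X₂ → IsSmoothProjective (2 * n) X₂ →
      IsFermatVariety (2 * n) 37 X₃ → IsSmoothProjective (2 * n) X₃ →
      IsFermatVariety (2 * n) 37 X₄ → IsSmoothProjective (2 * n) X₄ →
      IsFermatVariety (2 * n) 37 X₅ → IsSmoothProjective (2 * n) X₅ →
      IsFermatVariety (2 * n) 37 X₆ → IsSmoothProjective (2 * n) X₆ →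
      IsFermatVariety (2 * n) 37 X₇ → IsSmoothProjective (2 * n) X₇ →
      IsFermatVariety (2 * n) 37 X₈ → IsSmoothProjective (2 * n) X₈ →
      IsFermatVariety (2 * n) 37 X₉ → IsSmoothProjective (2 * n) X₉ →
      IsSmoothProjective B.dim T →
    ∀ (a : T ⟶ B.X), AlgebraicGeometry.Surjective a.left → ∀ (ι : Type) (b : ι → (T ⟶ (((((((X₁ ⊗ X₂) ⊗ X₃) ⊗ X₄) ⊗ X₅) ⊗ X₆) ⊗ X₇) ⊗ X₈) ⊗ X₉)),
      ∀ c ∈ weilClassesField B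
          (CategoryTheory.End.asHom (CategoryTheory.End.of s + CategoryTheory.End.of s ^ 7 + CategoryTheory.End.of s ^ 9 + CategoryTheory.End.of s ^ 10 + CategoryTheory.End.of s ^ 12 + CategoryTheory.End.of s ^ 16 + CategoryTheory.End.of s ^ 26 + CategoryTheory.End.of s ^ 33 + CategoryTheory.End.of s ^ 34 - CategoryTheory.End.of s ^ 3 - CategoryTheory.End.of s ^ 4 - CategoryTheory.End.of s ^ 11 - CategoryTheory.End.of s ^ 21 - CategoryTheory.End.of s ^ 25 - CategoryTheory.End.of s ^ 27 - CategoryTheory.End.of s ^ 28 - CategoryTheory.End.of s ^ 30 - CategoryTheory.End.of s ^ 36))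
          (X ^ 4 + 37 * X ^ 2 + 333 : Polynomial ℤ) (2 * (9 * n)),
        complexBetti.map a (2 * (9 * n)) c ∈ (⨆ i, (Submodule.span ℂ
            {x : complexBetti ((((((((X₁ ⊗ X₂) ⊗ X₃) ⊗ X₄) ⊗ X₅) ⊗ X₆) ⊗ X₇) ⊗ X₈) ⊗ X₉) (2 * (9 * n)) |
              IsRationalClass x ∧ IsOfHodgeType (2 * n + 2 * n + 2 * n + 2 * n + 2 * n + 2 * n + 2 * n + 2 * n + 2 * n) ((((((((X₁ ⊗ X₂) ⊗ X₃) ⊗ X₄) ⊗ X₅) ⊗ X₆) ⊗ X₇) ⊗ X₈) ⊗ X₉) (2 * (9 * n)) (9 * n) (9 * n) x}).map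
              (complexBetti.map (b i) (2 * (9 * n))).hom) →
        IsRationalClass c → IsOfHodgeType B.dim B.X (2 * (9 * n)) (9 * n) (9 * n) c → c ∈ algebraicClasses B.X (9 * n) := by
  intro B s n hs hdim _ _ _ _ _ _ _ _ _ _ _ _ _ _ _ _ _ _ _ _ _ _ _ _ _ _ _ _ _ _ _ _ _ c hcW _ hc hmm
  have hφ : Polynomial.eval₂ (Int.castRingHom (CategoryTheory.End B))
      ((CategoryTheory.End.asHom (CategoryTheory.End.of s + CategoryTheory.End.of s ^ 7 + CategoryTheory.End.of s ^ 9 + CategoryTheory.End.of s ^ 10 + CategoryTheory.End.of s ^ 12 + CategoryTheory.End.of s ^ 16 + CategoryTheory.End.of s ^ 26 + CategoryTheory.End.of s ^ 33 + CategoryTheory.End.of s ^ 34 - CategoryTheory.End.of s ^ 3 - CategoryTheory.End.of s ^ 4 - CategoryTheory.End.of s ^ 11 - CategoryTheory.End.of s ^ 21 - CategoryTheory.End.of s ^ 25 - CategoryTheory.End.of s ^ 27 - CategoryTheory.End.of s ^ 28 - CategoryTheory.End.of s ^ 30 - CategoryTheory.End.of s ^ 36) : B ⟶ B) :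
        CategoryTheory.End B) (X ^ 4 + 37 * X ^ 2 + 333 : Polynomial ℤ) = 0 :=
    eval₂_quarticThirtySeven_periodDiff (CategoryTheory.End.of s) hs
  exact hR B _ (X ^ 4 + 37 * X ^ 2 + 333 : Polynomial ℤ) 4 (9 * n) quarticThirtySeven_monic
    quarticThirtySeven_natDegree (by norm_num) quarticThirtySeven_irreducible hφ (by omega)
    (fun ρ hρ => conj_ne_self_of_quarticThirtySeven hρ) exists_conjPolynomial_quarticThirtySeven c hcW hc hmm

/-- **On-path lemma**: `HodgeConjecture → WeilClassesCMField →` R3 for `ℚ(ζ_37)^{C_9}` on the `ζ_37`-locus. -/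
theorem weilClassesCMField_cyclicPrymThirtySeven_quartic_of_hodgeConjecture (hH : _root_.HodgeConjecture) :
    ∀ (B : Motives.AbelianVariety ℂ) (s : B ⟶ B) (n : ℕ),
      Polynomial.eval₂ (Int.castRingHom (CategoryTheory.End B)) (s : CategoryTheory.End B)
        (Polynomial.cyclotomic 37 ℤ) = 0 → B.dim = 36 * n →
    ∀ (X₁ X₂ X₃ X₄ X₅ X₆ X₇ X₈ X₉ T : Motives.SchemeOver ℂ),
      IsFermatVariety (2 * n) 37 X₁ → IsSmoothProjective (2 * n) X₁ →
      IsFermatVariety (2 * n) 37 X₂ → IsSmoothProjective (2 * n) X₂ →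
      IsFermatVariety (2 * n) 37 X₃ → IsSmoothProjective (2 * n) X₃ →
      IsFermatVariety (2 * n) 37 X₄ → IsSmoothProjective (2 * n) X₄ →
      IsFermatVariety (2 * n) 37 X₅ → IsSmoothProjective (2 * n) X₅ →
      IsFermatVariety (2 * n) 37 X₆ → IsSmoothProjective (2 * n) X₆ →
      IsFermatVariety (2 * n) 37 X₇ → IsSmoothProjective (2 * n) X₇ →
      IsFermatVariety (2 * n) 37 X₈ → IsSmoothProjective (2 * n) X₈ →
      IsFermatVariety (2 * n) 37 X₉ → IsSmoothProjective (2 * n) X₉ →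
      IsSmoothProjective B.dim T →
    ∀ (a : T ⟶ B.X), AlgebraicGeometry.Surjective a.left → ∀ (ι : Type) (b : ι → (T ⟶ (((((((X₁ ⊗ X₂) ⊗ X₃) ⊗ X₄) ⊗ X₅) ⊗ X₆) ⊗ X₇) ⊗ X₈) ⊗ X₉)),
      ∀ c ∈ weilClassesField B
          (CategoryTheory.End.asHom (CategoryTheory.End.of s + CategoryTheory.End.of s ^ 7 + CategoryTheory.End.of s ^ 9 + CategoryTheory.End.of s ^ 10 + CategoryTheory.End.of s ^ 12 + CategoryTheory.End.of s ^ 16 + CategoryTheory.End.of s ^ 26 + CategoryTheory.End.of s ^ 33 + CategoryTheory.End.of s ^ 34 - CategoryTheory.End.of s ^ 3 - CategoryTheory.End.of s ^ 4 - CategoryTheory.End.of s ^ 11 - CategoryTheory.End.of s ^ 21 - CategoryTheory.End.of s ^ 25 - CategoryTheory.End.of s ^ 27 - CategoryTheory.End.of s ^ 28 - CategoryTheory.End.of s ^ 30 - CategoryTheory.End.of s ^ 36))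
          (X ^ 4 + 37 * X ^ 2 + 333 : Polynomial ℤ) (2 * (9 * n)),
        complexBetti.map a (2 * (9 * n)) c ∈ (⨆ i, (Submodule.span ℂ
            {x : complexBetti ((((((((X₁ ⊗ X₂) ⊗ X₃) ⊗ X₄) ⊗ X₅) ⊗ X₆) ⊗ X₇) ⊗ X₈) ⊗ X₉) (2 * (9 * n)) |
              IsRationalClass x ∧ IsOfHodgeType (2 * n + 2 * n + 2 * n + 2 * n + 2 * n + 2 * n + 2 * n + 2 * n + 2 * n) ((((((((X₁ ⊗ X₂) ⊗ X₃) ⊗ X₄) ⊗ X₅) ⊗ X₆) ⊗ X₇) ⊗ X₈) ⊗ X₉) (2 * (9 * n)) (9 * n) (9 * n) x}).map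
              (complexBetti.map (b i) (2 * (9 * n))).hom) →
        IsRationalClass c → IsOfHodgeType B.dim B.X (2 * (9 * n)) (9 * n) (9 * n) c → c ∈ algebraicClasses B.X (9 * n) :=
  weilClassesCMField_cyclicPrymThirtySeven_quartic_of_weilClassesCMField (weilClassesCMField_of_hodgeConjecture hH)

end ThirtySevenQuartic

end Summit.HodgeConjecture.HodgeConjecture.WeilTypeLadder

end
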